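import Literature.MathematicalPhysics.QuantumManyBody.PeriodicFeynmanKacCompact
import Mathlib.MeasureTheory.Integral.IntervalIntegral.AbsolutelyContinuousFun
import Mathlib.MeasureTheory.Integral.IntervalIntegral.LebesgueDifferentiationThm
import HarnessLib

/-!
# The Duhamel (variation-of-constants) identity for the periodic Feynman–Kac functional

Topic `Literature/MathematicalPhysics/QuantumManyBody`; sequel of `PeriodicHeatFlow.lean` /
`PeriodicFeynmanKacCompact.lean`. For `N` world-lines `B_s = X + √2 b_s` on `(ℝ³)^N`, a measurable
pair potential `v` whose periodisation is BOUNDED (`v^per ≤ C`, so that the periodic interaction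
`W = ∑_{i<j} v^per(xᵢ - xⱼ)` is bounded by `N²C`), a measurable observable `g ≥ 0` and `T ≥ 0`:

  `E[g(B_T)] = (e^{-TH} g)(X) + ∫_{s ∈ (0,T]} E[ W(B_s) · (e^{-(T-s)H} g)(B_s) ] ds`

(`periodicFKSemigroup_duhamel`), i.e. `P_T = e^{-TH} + ∫₀ᵀ P_s W e^{-(T-s)H} ds` tested at `X`,
where `P_s` is the FREE flow `E[·(B_s)]` and `e^{-tH} = periodicFKSemigroup v L t` is the
Feynman–Kac functional of `H = -Δ + W` (Chung–Zhao's `T_t`). All terms are `[0,∞]`-valued, so the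
identity needs no integrability hypothesis on `g`.

## Proof

* Pathwise (`exp_neg_integral_add_integral_mul_exp_neg`, `periodicFKWeight_add_lintegral_eq_one`):
  for the bounded measurable `w(r) = W(B_r(ω))`, `s ↦ exp(-∫ₛᵀ w)` is Lipschitz, hence absolutely
  continuous on `[0, T]`, with a.e. derivative `w(s) exp(-∫ₛᵀ w)` (Lebesgue's differentiation
  theorem, `IntervalIntegrable.ae_hasDerivAt_integral`), so the fundamental theorem of calculus
  for absolutely continuous functions (`AbsolutelyContinuousOnInterval.integral_deriv_eq_sub`) gives
  `e^{-∫₀ᵀ w} + ∫₀ᵀ w(s) e^{-∫ₛᵀ w} ds = 1`; in `[0,∞]`: `w_T + ∫_{(0,T]} W(B_s) expNeg(A_T - A_s) ds = 1`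
  with `A_s = ∫₀ˢ W(B_r) dr` the action and `w_T = expNeg A_T` the weight.
* Markov (`lintegral_interaction_mul_expNeg_mul_eq`): multiplying by `g(B_T)`, integrating over the
  Wiener measure and using Tonelli, the `s`-integrand `E[g(B_T) W(B_s) e^{-∫ₛᵀ W(B_r)dr}]` equals
  `E[W(B_s) (e^{-(T-s)H} g)(B_s)]` by the weak Markov property of the world-lines at time `s`
  (`lintegral_comp_pathsShift_eq`, exactly as in the semigroup law `periodicFKSemigroup_add_nnreal`,
  with the past factor `W(B_s)` in place of the weight `w_s`).

This is the probabilistic form of Duhamel's formula for `e^{-t(H₀+W)}` with bounded `W`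
(Chung–Zhao 1995, §3.2, the computation behind Thm 3.10 / Prop 3.12: `T_t - P_t` expanded in the
potential); it is the input of the `C¹`-regularity of Feynman–Kac eigenfunctions for bounded
measurable (discontinuous) periodised potentials (crux `HardCoreExtension`, line
`third-law-current-floor`, stubs `stub_mildDuhamelFK` / `stub_forwardDuhamelOfMild`).

## References

* K. L. Chung, Z. Zhao, *From Brownian Motion to Schrödinger's Equation*, Springer (1995), §3.2.
* B. Simon, *Functional Integration and Quantum Physics* (1979), §6 (Duhamel / Du Hamel expansion
  of Feynman–Kac semigroups).
-/

noncomputable section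

open MeasureTheory Filter Set intervalIntegral
open scoped ENNReal NNReal Topology
open Literature.Probability.Process

namespace Literature.MathematicalPhysics.QuantumManyBody.BoseGas

/-! ### The pathwise identity `e^{-∫₀ᵀ w} + ∫₀ᵀ w(s) e^{-∫ₛᵀ w} ds = 1` -/

/-- `|eᵃ - eᵇ| ≤ e^{max a b} |a - b|` (convexity: `1 + t ≤ eᵗ`). [folklore] -/
theorem abs_exp_sub_exp_le_exp_max_mul (a b : ℝ) :
    |Real.exp a - Real.exp b| ≤ Real.exp (max a b) * |a - b| := by
  -- `eᵃ - eᵇ ≤ eᵃ (a - b)` and symmetrically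
  have key : ∀ x y : ℝ, Real.exp x - Real.exp y ≤ Real.exp x * (x - y) := by
    intro x y
    have h := Real.add_one_le_exp (y - x)
    have hx := Real.exp_pos x
    have : Real.exp y = Real.exp x * Real.exp (y - x) := by rw [← Real.exp_add]; ring_nf
    nlinarith [mul_le_mul_of_nonneg_left h hx.le]
  rw [abs_le]
  constructor
  · have h1 := key b a
    have h2 : Real.exp b * (b - a) ≤ Real.exp (max a b) * |a - b| := by
      calc Real.exp b * (b - a) ≤ Real.exp b * |a - b| := by
            refine mul_le_mul_of_nonneg_left ?_ (Real.exp_pos b).le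
            rw [abs_sub_comm]; exact le_abs_self _
        _ ≤ Real.exp (max a b) * |a - b| :=
            mul_le_mul_of_nonneg_right (Real.exp_le_exp.2 (le_max_right a b)) (abs_nonneg _)
    linarith
  · have h1 := key a b
    calc Real.exp a - Real.exp b ≤ Real.exp a * (a - b) := h1
      _ ≤ Real.exp a * |a - b| := mul_le_mul_of_nonneg_left (le_abs_self _) (Real.exp_pos a).le
      _ ≤ Real.exp (max a b) * |a - b| :=
          mul_le_mul_of_nonneg_right (Real.exp_le_exp.2 (le_max_left a b)) (abs_nonneg _)

/-- A bounded measurable real function is interval integrable on every interval. [folklore] -/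
theorem intervalIntegrable_of_measurable_norm_le {w : ℝ → ℝ} (hw : Measurable w) {K : ℝ}
    (hK : ∀ r, ‖w r‖ ≤ K) (a b : ℝ) : IntervalIntegrable w volume a b := by
  rw [intervalIntegrable_iff]
  exact Measure.integrableOn_of_bounded (by rw [Real.volume_uIoc]; exact ENNReal.ofReal_ne_top)
    hw.aestronglyMeasurable (Eventually.of_forall fun r => hK r)

/-- **The pathwise Duhamel identity.** For a bounded measurable `w : ℝ → ℝ` and `T ≥ 0`,
`exp(-∫₀ᵀ w) + ∫₀ᵀ w(s) exp(-∫ₛᵀ w(r) dr) ds = 1`: the function `s ↦ exp(-∫ₛᵀ w)` is Lipschitz,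
hence absolutely continuous, its a.e. derivative is `w(s) exp(-∫ₛᵀ w)` (Lebesgue's differentiation
theorem), and the fundamental theorem of calculus for absolutely continuous functions applies.
[folklore] -/
theorem exp_neg_integral_add_integral_mul_exp_neg {w : ℝ → ℝ} (hw : Measurable w) {K : ℝ}
    (hK : ∀ r, ‖w r‖ ≤ K) {T : ℝ} (hT : 0 ≤ T) :
    Real.exp (-(∫ r in (0 : ℝ)..T, w r)) +
      ∫ s in (0 : ℝ)..T, w s * Real.exp (-(∫ r in s..T, w r)) = 1 := by
  have hK0 : 0 ≤ K := (norm_nonneg _).trans (hK 0)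
  have hint : ∀ a b : ℝ, IntervalIntegrable w volume a b := intervalIntegrable_of_measurable_norm_le hw hK
  -- the primitive `U s = ∫₀ˢ w` and `Φ s = exp (U s - U T) = exp (-∫ₛᵀ w)`
  set U : ℝ → ℝ := fun s => ∫ r in (0 : ℝ)..s, w r with hU
  set Φ : ℝ → ℝ := fun s => Real.exp (U s - U T) with hΦ
  have hUT : ∀ s, ∫ r in s..T, w r = U T - U s := fun s =>
    (integral_interval_sub_left (hint 0 T) (hint 0 s)).symm
  have hΦ' : ∀ s, Real.exp (-(∫ r in s..T, w r)) = Φ s := fun s => by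
    rw [hUT, hΦ]; congr 1; ring
  -- `U` is `K`-Lipschitz
  have hUlip : ∀ x y : ℝ, |U x - U y| ≤ K * |x - y| := by
    intro x y
    rw [hU]; dsimp only
    rw [integral_interval_sub_left (hint 0 x) (hint 0 y), ← Real.norm_eq_abs]
    exact norm_integral_le_of_norm_le_const fun r _ => hK r
  -- on `[0, T]` the exponent is bounded by `K * T`
  have hbd : ∀ s ∈ uIcc (0 : ℝ) T, U s - U T ≤ K * T := by
    intro s hs
    rw [uIcc_of_le hT] at hs
    have h1 : U s - U T ≤ |U s - U T| := le_abs_self _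
    have h2 : |s - T| ≤ T := by
      rw [abs_sub_comm, abs_of_nonneg (by linarith [hs.2])]; linarith [hs.1]
    calc U s - U T ≤ K * |s - T| := h1.trans (hUlip s T)
      _ ≤ K * T := mul_le_mul_of_nonneg_left h2 hK0
  -- `Φ` is Lipschitz on `[0, T]`, hence absolutely continuous
  have hΦlip : LipschitzOnWith (Real.toNNReal (Real.exp (K * T) * K)) Φ (uIcc (0 : ℝ) T) := by
    refine LipschitzOnWith.of_dist_le_mul fun x hx y hy => ?_
    rw [Real.dist_eq, Real.dist_eq, Real.coe_toNNReal _ (by positivity), hΦ]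
    dsimp only
    calc |Real.exp (U x - U T) - Real.exp (U y - U T)|
        ≤ Real.exp (max (U x - U T) (U y - U T)) * |U x - U T - (U y - U T)| :=
          abs_exp_sub_exp_le_exp_max_mul _ _
      _ ≤ Real.exp (K * T) * (K * |x - y|) := by
          refine mul_le_mul (Real.exp_le_exp.2 (max_le (hbd x hx) (hbd y hy))) ?_ (abs_nonneg _)
            (Real.exp_pos _).le
          rw [show U x - U T - (U y - U T) = U x - U y by ring]
          exact hUlip x y
      _ = Real.exp (K * T) * K * |x - y| := by ring
  have hΦac : AbsolutelyContinuousOnInterval Φ 0 T := hΦlip.absolutelyContinuousOnInterval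
  -- FTC for absolutely continuous functions
  have hftc := hΦac.integral_deriv_eq_sub
  have hΦT : Φ T = 1 := by rw [hΦ]; simp
  have hΦ0 : Φ 0 = Real.exp (-(∫ r in (0 : ℝ)..T, w r)) := by
    rw [← hΦ' 0]
  -- the a.e. derivative: `deriv Φ s = w s * Φ s`
  have hderiv : ∀ᵐ s, s ∈ uIoc (0 : ℝ) T → deriv Φ s = w s * Φ s := by
    filter_upwards [(hint 0 T).ae_hasDerivAt_integral] with s hs hsI
    have hs' : s ∈ uIcc (0 : ℝ) T := uIoc_subset_uIcc hsI
    have hUd : HasDerivAt U (w s) s := hs hs' 0 (by rw [uIcc_of_le hT]; exact ⟨le_rfl, hT⟩)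
    have hΦd : HasDerivAt Φ (Real.exp (U s - U T) * (w s - 0)) s := by
      rw [hΦ]
      exact (hUd.sub_const (U T)).exp |>.congr_deriv (by simp)
    rw [hΦd.deriv, sub_zero, mul_comm]
  have hcongr : ∫ s in (0 : ℝ)..T, deriv Φ s = ∫ s in (0 : ℝ)..T, w s * Φ s :=
    integral_congr_ae hderiv
  -- assemble
  have hmain : ∫ s in (0 : ℝ)..T, w s * Real.exp (-(∫ r in s..T, w r)) =
      1 - Real.exp (-(∫ r in (0 : ℝ)..T, w r)) := by
    simp_rw [hΦ']
    rw [← hcongr, hftc, hΦT, hΦ0]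
  rw [hmain]; ring

variable {N : ℕ}

/-! ### The periodic weight along one sample path -/

/-- The interaction read along a sample path, `r ↦ W(B_r)`, is measurable in the time. [folklore] -/
theorem measurable_periodicInteraction_worldLine {v : ℝ → ℝ≥0∞} (hv : Measurable v) (L : ℝ)
    (X : Config N) (ω : PathSpace N) :
    Measurable fun r : ℝ => periodicInteraction v L (worldLine X ω r.toNNReal) :=
  (measurable_periodicInteraction hv L).comp (continuous_worldLine_toNNReal X ω).measurable

/-- For a bounded periodised potential the action up to time `s ≥ 0` is the `ofReal` of the
Bochner time-integral of the real interaction along the path. [folklore] -/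
theorem periodicPathAction_eq_ofReal_integral {v : ℝ → ℝ≥0∞} (hv : Measurable v) {L : ℝ}
    {C : ℝ≥0} (hC : ∀ x, periodizedPotential v L x ≤ C) {s : ℝ} (hs : 0 ≤ s) (X : Config N)
    (ω : PathSpace N) :
    periodicPathAction v L s X ω =
      ENNReal.ofReal (∫ r in (0 : ℝ)..s,
        (periodicInteraction v L (worldLine X ω r.toNNReal)).toReal) := by
  have hne : ∀ r : ℝ, periodicInteraction v L (worldLine X ω r.toNNReal) ≠ ⊤ := fun r =>
    ne_top_of_le_ne_top (ENNReal.mul_ne_top (ENNReal.natCast_ne_top _) ENNReal.coe_ne_top)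
      (periodicInteraction_le_of_bound (C := (C : ℝ≥0∞)) (fun x => hC x) _)
  have hmeas := measurable_periodicInteraction_worldLine hv L X ω
  rw [periodicPathAction, integral_of_le hs, ofReal_integral_eq_lintegral_ofReal]
  · refine setLIntegral_congr_fun measurableSet_Ioc fun r _ => ?_
    rw [ENNReal.ofReal_toReal (hne r)]
  · refine Measure.integrableOn_of_bounded (M := ((N * N : ℕ) : ℝ) * C) measure_Ioc_lt_top.ne
      hmeas.ennreal_toReal.aestronglyMeasurable (Eventually.of_forall fun r => ?_)
    rw [Real.norm_eq_abs, abs_of_nonneg ENNReal.toReal_nonneg]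
    have h := periodicInteraction_le_of_bound (C := (C : ℝ≥0∞)) (fun x => hC x)
      (worldLine X ω r.toNNReal)
    have h' := ENNReal.toReal_mono (ENNReal.mul_ne_top (ENNReal.natCast_ne_top _)
      ENNReal.coe_ne_top) h
    simpa [ENNReal.toReal_mul] using h'
  · exact Eventually.of_forall fun r => ENNReal.toReal_nonneg

/-- **The pathwise Duhamel identity of the periodic weight.** For a bounded periodised potential,
`T ≥ 0` and every sample path,
`w_T + ∫_{(0,T]} W(B_s) · expNeg(A_T - A_s) ds = 1` (`A_s = ∫₀ˢ W(B_r) dr` the action,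
`w_T = expNeg A_T` the weight): the real identity `e^{-∫₀ᵀ w} + ∫₀ᵀ w(s) e^{-∫ₛᵀ w} ds = 1` for
the bounded measurable `w(r) = W(B_r)`. [folklore] -/
theorem periodicFKWeight_add_lintegral_eq_one {v : ℝ → ℝ≥0∞} (hv : Measurable v) {L : ℝ}
    {C : ℝ≥0} (hC : ∀ x, periodizedPotential v L x ≤ C) {T : ℝ} (hT : 0 ≤ T) (X : Config N)
    (ω : PathSpace N) :
    periodicFKWeight v L T X ω +
        ∫⁻ s in Set.Ioc (0 : ℝ) T, periodicInteraction v L (worldLine X ω s.toNNReal) *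
          expNeg (periodicPathAction v L T X ω - periodicPathAction v L s X ω) = 1 := by
  -- the real interaction along the path and its bound
  set w : ℝ → ℝ := fun r => (periodicInteraction v L (worldLine X ω r.toNNReal)).toReal with hw
  have hne : ∀ r : ℝ, periodicInteraction v L (worldLine X ω r.toNNReal) ≠ ⊤ := fun r =>
    ne_top_of_le_ne_top (ENNReal.mul_ne_top (ENNReal.natCast_ne_top _) ENNReal.coe_ne_top)
      (periodicInteraction_le_of_bound (C := (C : ℝ≥0∞)) (fun x => hC x) _)
  have hwm : Measurable w := (measurable_periodicInteraction_worldLine hv L X ω).ennreal_toReal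
  have hw0 : ∀ r, 0 ≤ w r := fun r => ENNReal.toReal_nonneg
  have hwK : ∀ r, ‖w r‖ ≤ ((N * N : ℕ) : ℝ) * C := by
    intro r
    rw [Real.norm_eq_abs, abs_of_nonneg (hw0 r)]
    have h := periodicInteraction_le_of_bound (C := (C : ℝ≥0∞)) (fun x => hC x)
      (worldLine X ω r.toNNReal)
    have h' := ENNReal.toReal_mono (ENNReal.mul_ne_top (ENNReal.natCast_ne_top _)
      ENNReal.coe_ne_top) h
    simpa [ENNReal.toReal_mul] using h'
  have hint : ∀ a b : ℝ, IntervalIntegrable w volume a b := intervalIntegrable_of_measurable_norm_le hwm hwK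
  -- the action as a real integral
  have hA : ∀ s, 0 ≤ s → periodicPathAction v L s X ω = ENNReal.ofReal (∫ r in (0 : ℝ)..s, w r) :=
    fun s hs => periodicPathAction_eq_ofReal_integral hv hC hs X ω
  have hI0 : ∀ s, 0 ≤ s → 0 ≤ ∫ r in (0 : ℝ)..s, w r := fun s hs =>
    intervalIntegral.integral_nonneg hs fun r _ => hw0 r
  -- the weight
  have hweight : periodicFKWeight v L T X ω =
      ENNReal.ofReal (Real.exp (-(∫ r in (0 : ℝ)..T, w r))) := by
    rw [periodicFKWeight, hA T hT, expNeg, if_neg ENNReal.ofReal_ne_top,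
      ENNReal.toReal_ofReal (hI0 T hT)]
  -- the integrand on `(0, T]`
  have hintegrand : ∀ s ∈ Set.Ioc (0 : ℝ) T,
      periodicInteraction v L (worldLine X ω s.toNNReal) *
          expNeg (periodicPathAction v L T X ω - periodicPathAction v L s X ω) =
        ENNReal.ofReal (w s * Real.exp (-(∫ r in s..T, w r))) := by
    intro s hs
    have hs0 : 0 ≤ s := hs.1.le
    have hsub : periodicPathAction v L T X ω - periodicPathAction v L s X ω =
        ENNReal.ofReal (∫ r in s..T, w r) := by
      rw [hA T hT, hA s hs0, ← ENNReal.ofReal_sub _ (hI0 s hs0),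
        integral_interval_sub_left (hint 0 T) (hint 0 s)]
    have hsT : 0 ≤ ∫ r in s..T, w r := intervalIntegral.integral_nonneg hs.2 fun r _ => hw0 r
    rw [hsub, expNeg, if_neg ENNReal.ofReal_ne_top, ENNReal.toReal_ofReal hsT,
      ← ENNReal.ofReal_toReal (hne s), ← ENNReal.ofReal_mul (hw0 s)]
  -- the Bochner form of the time integral
  have hF : ∀ s, Real.exp (-(∫ r in s..T, w r)) =
      Real.exp ((∫ r in (0 : ℝ)..s, w r) - ∫ r in (0 : ℝ)..T, w r) := by
    intro s
    rw [← integral_interval_sub_left (hint 0 T) (hint 0 s)]; congr 1; ring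
  have hcontU : Continuous fun s => ∫ r in (0 : ℝ)..s, w r :=
    continuous_primitive (fun a b => hint a b) 0
  have hmeas : Measurable fun s => w s * Real.exp (-(∫ r in s..T, w r)) := by
    simp_rw [hF]
    exact hwm.mul (Real.measurable_exp.comp (hcontU.measurable.sub measurable_const))
  have hbound : ∀ s ∈ Set.Ioc (0 : ℝ) T, ‖w s * Real.exp (-(∫ r in s..T, w r))‖ ≤
      ((N * N : ℕ) : ℝ) * C := by
    intro s hs
    have hsT : 0 ≤ ∫ r in s..T, w r := intervalIntegral.integral_nonneg hs.2 fun r _ => hw0 r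
    rw [norm_mul, Real.norm_eq_abs (Real.exp _), abs_of_pos (Real.exp_pos _)]
    calc ‖w s‖ * Real.exp (-(∫ r in s..T, w r)) ≤ ‖w s‖ * 1 := by
          refine mul_le_mul_of_nonneg_left ?_ (norm_nonneg _)
          rw [Real.exp_le_one_iff]; linarith
      _ ≤ ((N * N : ℕ) : ℝ) * C := by rw [mul_one]; exact hwK s
  have hintegrable : IntegrableOn (fun s => w s * Real.exp (-(∫ r in s..T, w r)))
      (Set.Ioc (0 : ℝ) T) volume :=
    Measure.integrableOn_of_bounded measure_Ioc_lt_top.ne hmeas.aestronglyMeasurable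
      ((ae_restrict_iff' measurableSet_Ioc).2 (Eventually.of_forall hbound))
  have hlin : ∫⁻ s in Set.Ioc (0 : ℝ) T, periodicInteraction v L (worldLine X ω s.toNNReal) *
        expNeg (periodicPathAction v L T X ω - periodicPathAction v L s X ω) =
      ENNReal.ofReal (∫ s in (0 : ℝ)..T, w s * Real.exp (-(∫ r in s..T, w r))) := by
    rw [setLIntegral_congr_fun measurableSet_Ioc hintegrand, integral_of_le hT,
      ofReal_integral_eq_lintegral_ofReal hintegrable]
    exact (ae_restrict_iff' measurableSet_Ioc).2 (Eventually.of_forall fun s hs =>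
      mul_nonneg (hw0 s) (Real.exp_pos _).le)
  have hpos2 : 0 ≤ ∫ s in (0 : ℝ)..T, w s * Real.exp (-(∫ r in s..T, w r)) :=
    intervalIntegral.integral_nonneg hT fun s _ => mul_nonneg (hw0 s) (Real.exp_pos _).le
  rw [hweight, hlin, ← ENNReal.ofReal_add (Real.exp_pos _).le hpos2,
    exp_neg_integral_add_integral_mul_exp_neg hwm hwK hT, ENNReal.ofReal_one]

/-! ### The Markov step -/

/-- **Markov step of the Duhamel identity.** For `ℝ≥0` times `σ, t`, measurable `v`, `g` and every
`X`: `E[ W(B_σ) · e^{-∫₀ᵗ W(B_{σ+r}) dr} · g(B_{σ+t}) ] = E[ W(B_σ) · (e^{-tH} g)(B_σ) ]` — the weak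
Markov property of the world-lines at time `σ` (`lintegral_comp_pathsShift_eq`) applied to the raw
functional `w ↦ e^{-∫₀ᵗ V^per} g(B_t)` started from `B_σ`, with the past factor `W(B_σ)` in place
of the weight (compare `periodicFKSemigroup_add_nnreal`). [folklore] -/
theorem lintegral_interaction_mul_expNeg_mul_eq {v : ℝ → ℝ≥0∞} (hv : Measurable v) (L : ℝ)
    (σ t : ℝ≥0) {g : Config N → ℝ≥0∞} (hg : Measurable g) (X : Config N) :
    ∫⁻ ω, periodicInteraction v L (worldLine X ω σ) *
        expNeg (∫⁻ r in Set.Ioc (0 : ℝ) t,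
          periodicInteraction v L (worldLine X ω (σ + r.toNNReal))) *
        g (worldLine X ω (σ + t)) ∂wienerPaths N =
      ∫⁻ ω, periodicInteraction v L (worldLine X ω σ) *
        periodicFKSemigroup v L t g (worldLine X ω σ) ∂wienerPaths N := by
  -- measurability of the raw functional `G((a, Y), w) = a · rawWeight t Y w · g(rawWorldLine Y w t)`
  have hGm : Measurable fun q : (ℝ≥0∞ × Config N) × PathSpace N =>
      q.1.1 * ((fun p : Config N × PathSpace N => expNeg (∫⁻ r in Set.Ioc (0 : ℝ) t,
        periodicInteraction v L (fun i : Fin N => p.1 i + WithLp.toLp 2 (fun k : Fin 3 =>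
          Real.sqrt 2 * pathRegularize (p.2 i k) r.toNNReal)))) (q.1.2, q.2) *
        g (fun i : Fin N => q.1.2 i + WithLp.toLp 2 (fun k : Fin 3 =>
          Real.sqrt 2 * pathRegularize (q.2 i k) t))) := by
    have hπ : Measurable fun q : (ℝ≥0∞ × Config N) × PathSpace N => (q.1.2, q.2) :=
      (measurable_snd.comp measurable_fst).prodMk measurable_snd
    refine (measurable_fst.comp measurable_fst).mul ?_
    exact ((measurable_rawPeriodicWeight N hv L t).comp hπ).mul
      (hg.comp ((measurable_rawWorldLine_at' N t).comp hπ))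
  -- the past datum `(W(B_σ), B_σ)` is a functional of the past
  have hF : Measurable fun p : ℝ≥0∞ × Config N => (periodicInteraction v L p.2, p.2) :=
    ((measurable_periodicInteraction hv L).comp measurable_snd).prodMk measurable_snd
  have hξ := hF.comp (measurable_comap_past_periodicFKWeight_worldLine hv L σ X)
  have key := lintegral_comp_pathsShift_eq N σ hξ hGm
  simp only [Function.comp_apply, raw_worldLine_pathsShift, raw_worldLine_pathsPath] at key
  simp only [mul_assoc]
  rw [key]
  refine lintegral_congr fun ω => ?_
  rw [periodicFKSemigroup, ← lintegral_const_mul]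
  · simp only [periodicFKWeight, periodicPathAction, Real.toNNReal_coe]
  · exact (measurable_periodicFKWeight hv L t _).mul (hg.comp (measurable_worldLine _ _))


/-! ### Measurability in the time variable -/

/-- The action is continuous in the (real) time, for a bounded periodised potential and every path.
[folklore] -/
theorem continuous_periodicPathAction_time {v : ℝ → ℝ≥0∞} (hv : Measurable v) {L : ℝ}
    {C : ℝ≥0} (hC : ∀ x, periodizedPotential v L x ≤ C) (X : Config N) (ω : PathSpace N) :
    Continuous fun s : ℝ => periodicPathAction v L s X ω := by
  set w : ℝ → ℝ := fun r => (periodicInteraction v L (worldLine X ω r.toNNReal)).toReal with hw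
  have hwm : Measurable w := (measurable_periodicInteraction_worldLine hv L X ω).ennreal_toReal
  have hwK : ∀ r, ‖w r‖ ≤ ((N * N : ℕ) : ℝ) * C := by
    intro r
    rw [Real.norm_eq_abs, abs_of_nonneg ENNReal.toReal_nonneg]
    have h := periodicInteraction_le_of_bound (C := (C : ℝ≥0∞)) (fun x => hC x)
      (worldLine X ω r.toNNReal)
    have h' := ENNReal.toReal_mono (ENNReal.mul_ne_top (ENNReal.natCast_ne_top _)
      ENNReal.coe_ne_top) h
    simpa [ENNReal.toReal_mul] using h'
  have hint : ∀ a b : ℝ, IntervalIntegrable w volume a b := intervalIntegrable_of_measurable_norm_le hwm hwK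
  have hcontU : Continuous fun s => ∫ r in (0 : ℝ)..s, w r :=
    continuous_primitive (fun a b => hint a b) 0
  have heq : (fun s : ℝ => periodicPathAction v L s X ω) =
      fun s => ENNReal.ofReal (∫ r in (0 : ℝ)..(max s 0), w r) := by
    funext s
    rcases le_or_gt s 0 with hs | hs
    · rw [periodicPathAction_of_nonpos v L hs, max_eq_right hs, intervalIntegral.integral_same,
        ENNReal.ofReal_zero]
    · rw [max_eq_left hs.le]
      exact periodicPathAction_eq_ofReal_integral hv hC hs.le X ω
  rw [heq]
  exact ENNReal.continuous_ofReal.comp (hcontU.comp (continuous_id.max continuous_const))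

/-- The action is jointly measurable in (path, time), for a bounded periodised potential.
[folklore] -/
theorem measurable_periodicPathAction_prod {v : ℝ → ℝ≥0∞} (hv : Measurable v) {L : ℝ}
    {C : ℝ≥0} (hC : ∀ x, periodizedPotential v L x ≤ C) (X : Config N) :
    Measurable fun p : PathSpace N × ℝ => periodicPathAction v L p.2 X p.1 := by
  have h : Measurable (Function.uncurry fun (s : ℝ) (ω : PathSpace N) =>
      periodicPathAction v L s X ω) :=
    measurable_uncurry_of_continuous_of_measurable
      (fun ω => continuous_periodicPathAction_time hv hC X ω)
      (fun s => measurable_periodicPathAction hv L s X)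
  exact h.comp measurable_swap

/-- The interaction along the world-line is jointly measurable in (path, time). [folklore] -/
theorem measurable_periodicInteraction_worldLine_prod {v : ℝ → ℝ≥0∞} (hv : Measurable v)
    (L : ℝ) (X : Config N) :
    Measurable fun p : PathSpace N × ℝ => periodicInteraction v L (worldLine X p.1 p.2.toNNReal) :=
  (measurable_periodicInteraction hv L).comp
    (measurable_worldLine_prod.comp ((measurable_const.prodMk measurable_fst).prodMk measurable_snd))

/-! ### The Duhamel identity -/

/-- **Duhamel's identity for the periodic Feynman–Kac functional** (variation of constants against
the free flow). For a measurable pair potential `v` with bounded periodisation `v^per ≤ C`, a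
measurable observable `g : (ℝ³)^N → [0,∞]`, `T ≥ 0` and every starting point `X`:
`E[g(B_T)] = (e^{-TH} g)(X) + ∫_{s∈(0,T]} E[ W(B_s) · (e^{-(T-s)H} g)(B_s) ] ds`, where
`B_s = X + √2 b_s` are the world-lines, `W = ∑_{i<j} v^per(xᵢ - xⱼ)` the periodic interaction and
`e^{-tH} = periodicFKSemigroup v L t`. Equivalently `P_T = e^{-TH} + ∫₀ᵀ P_s W e^{-(T-s)H} ds`
with `P_s` the free heat flow. [cite: ChungZhao1995, §3.2 (26) and Thm 3.10] -/
theorem periodicFKSemigroup_duhamel {v : ℝ → ℝ≥0∞} (hv : Measurable v) {L : ℝ} {C : ℝ≥0}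
    (hC : ∀ x, periodizedPotential v L x ≤ C) {g : Config N → ℝ≥0∞} (hg : Measurable g)
    {T : ℝ} (hT : 0 ≤ T) (X : Config N) :
    ∫⁻ ω, g (worldLine X ω T.toNNReal) ∂wienerPaths N =
      periodicFKSemigroup v L T g X +
        ∫⁻ s in Set.Ioc (0 : ℝ) T, ∫⁻ ω,
          periodicInteraction v L (worldLine X ω s.toNNReal) *
            periodicFKSemigroup v L (T - s) g (worldLine X ω s.toNNReal) ∂wienerPaths N := by
  -- joint measurability of the `s`-integrand of the pathwise identity
  have hIm : Measurable fun p : PathSpace N × ℝ =>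
      periodicInteraction v L (worldLine X p.1 p.2.toNNReal) *
        expNeg (periodicPathAction v L T X p.1 - periodicPathAction v L p.2 X p.1) := by
    have h2 : Measurable fun p : PathSpace N × ℝ =>
        periodicPathAction v L T X p.1 - periodicPathAction v L p.2 X p.1 :=
      ((measurable_periodicPathAction hv L T X).comp measurable_fst).sub
        (measurable_periodicPathAction_prod hv hC X)
    exact (measurable_periodicInteraction_worldLine_prod hv L X).mul (measurable_expNeg.comp h2)
  have hIs : ∀ ω : PathSpace N, Measurable fun s : ℝ =>
      periodicInteraction v L (worldLine X ω s.toNNReal) *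
        expNeg (periodicPathAction v L T X ω - periodicPathAction v L s X ω) := fun ω =>
    (measurable_periodicInteraction_worldLine hv L X ω).mul (measurable_expNeg.comp
      (measurable_const.sub (continuous_periodicPathAction_time hv hC X ω).measurable))
  have hgT : Measurable fun ω : PathSpace N => g (worldLine X ω T.toNNReal) :=
    hg.comp (measurable_worldLine X _)
  -- Step 1: insert the pathwise identity `w_T + ∫ I = 1`
  have h1 : ∫⁻ ω, g (worldLine X ω T.toNNReal) ∂wienerPaths N =
      ∫⁻ ω, (g (worldLine X ω T.toNNReal) * periodicFKWeight v L T X ω +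
        g (worldLine X ω T.toNNReal) * (∫⁻ s in Set.Ioc (0 : ℝ) T,
          periodicInteraction v L (worldLine X ω s.toNNReal) *
            expNeg (periodicPathAction v L T X ω - periodicPathAction v L s X ω)))
        ∂wienerPaths N := by
    refine lintegral_congr fun ω => ?_
    rw [← mul_add, periodicFKWeight_add_lintegral_eq_one hv hC hT X ω, mul_one]
  rw [h1, lintegral_add_left (f := fun ω => g (worldLine X ω T.toNNReal) * periodicFKWeight v L T X ω)
    (by exact hgT.mul (measurable_periodicFKWeight hv L T X))]
  congr 1
  · -- the Feynman–Kac term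
    simp only [periodicFKSemigroup, mul_comm]
  · -- Step 2: constant inside, Tonelli
    have h2 : ∀ ω, (g (worldLine X ω T.toNNReal) * ∫⁻ s in Set.Ioc (0 : ℝ) T,
          periodicInteraction v L (worldLine X ω s.toNNReal) *
            expNeg (periodicPathAction v L T X ω - periodicPathAction v L s X ω)) =
        ∫⁻ s in Set.Ioc (0 : ℝ) T, g (worldLine X ω T.toNNReal) *
          (periodicInteraction v L (worldLine X ω s.toNNReal) *
            expNeg (periodicPathAction v L T X ω - periodicPathAction v L s X ω)) := fun ω =>
      (lintegral_const_mul _ (hIs ω)).symm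
    simp_rw [h2]
    rw [lintegral_lintegral_swap ((hgT.comp measurable_fst).mul hIm).aemeasurable]
    -- Step 3: Markov at each time `s ∈ (0, T]`
    refine setLIntegral_congr_fun measurableSet_Ioc fun s hs => ?_
    have hs0 : 0 ≤ s := hs.1.le
    have hTs : 0 ≤ T - s := sub_nonneg.2 hs.2
    have hsplit : T.toNNReal = s.toNNReal + (T - s).toNNReal := by
      rw [← Real.toNNReal_add hs0 hTs]; congr 1; ring
    have hcoe : ((s.toNNReal : ℝ) + (T - s).toNNReal) = T := by
      rw [Real.coe_toNNReal _ hs0, Real.coe_toNNReal _ hTs]; ring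
    have hpath : ∀ ω, periodicPathAction v L T X ω - periodicPathAction v L s X ω =
        ∫⁻ r in Set.Ioc (0 : ℝ) ((T - s).toNNReal : ℝ),
          periodicInteraction v L (worldLine X ω (s.toNNReal + r.toNNReal)) := by
      intro ω
      have hadd := periodicPathAction_add v L s.toNNReal (T - s).toNNReal X ω
      rw [hcoe, Real.coe_toNNReal _ hs0] at hadd
      rw [hadd, ENNReal.add_sub_cancel_left]
      exact ne_top_of_le_ne_top (ENNReal.mul_ne_top (ENNReal.mul_ne_top
        (ENNReal.natCast_ne_top _) ENNReal.coe_ne_top) ENNReal.ofReal_ne_top)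
        (periodicPathAction_le_of_bound (C := (C : ℝ≥0∞)) (fun x => hC x) s X ω)
    have hlhs : ∀ ω, g (worldLine X ω T.toNNReal) *
          (periodicInteraction v L (worldLine X ω s.toNNReal) *
            expNeg (periodicPathAction v L T X ω - periodicPathAction v L s X ω)) =
        periodicInteraction v L (worldLine X ω s.toNNReal) *
          expNeg (∫⁻ r in Set.Ioc (0 : ℝ) ((T - s).toNNReal : ℝ),
            periodicInteraction v L (worldLine X ω (s.toNNReal + r.toNNReal))) *
          g (worldLine X ω (s.toNNReal + (T - s).toNNReal)) := by
      intro ω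
      rw [hpath ω, ← hsplit, mul_comm, mul_assoc]
    simp_rw [hlhs]
    rw [lintegral_interaction_mul_expNeg_mul_eq hv L s.toNNReal (T - s).toNNReal hg X,
      Real.coe_toNNReal _ hTs]

end Literature.MathematicalPhysics.QuantumManyBody.BoseGas

end
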